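import Summits.ABC.IUTFork.Repair.RH2SigmaHullChosen
import Summits.ABC.IUTFork.Repair.RHHeightClassGlue
import Summits.ABC.IUTFork.Cor312LicenceShallowMultiSlotGenuineKInhabited
import HarnessLib

/-!
# R-H ROUND 2, Q2 «S restricted to Σ» — row 8 «heightclass» BY CONTAINMENT IN ROW 15 at the genuine bed (seat abc-iut-rh2-q2-hull):
# `HBand` datum ⟹ a CERTIFIED slot-reach dictionary (datum ∈ Σ₈ ⟹ datum ∈ Σ₁₅, in kernel) ⟹ the hSHw body ⟹ the Σ₈ certificate

PROOF-ONLY file (D-0012: 0 definitions, 0 `Prop` facts; abc-iut cell, rung LADDER-ABC:A2.RESCUE.H; seat abc-iut-rh2-q2-hull gen 0; companions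
`Repair/RH2SigmaHull.lean` p469248, `Repair/RH2SigmaHullChosen.lean`). TAKES NO SIDE on [IUTchIII] Cor. 3.12 or on any author; the row-8 candidate
`RHHeightClass.HBand` (abc-iut-lens-strengthen-1 / abc-iut-rh-typ-8 p459046) and the row-15 window `RHSlotReach.SlotReachWindow(K)` are HYPOTHESIS
SHAPES, never asserted; typed ≠ proved; instantiated ≠ endorsed; nothing here asserts abc.

ROUND-2 START-HERE §2: «rows 8/16/18 as corollaries by containment (8 ⊆ 15 via p460910 …)». The round-1 containment p460910
(`RHHeightClassGlue.slotReachWindow_of_hBand`) reads the dictionary UNIFORMLY per prime (`e ≡ e_p` at EVERY place over `p`), which a genuine `K`-level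
datum need not satisfy off its bad fibres; abc-iut-rp-m2's k2 statement of record `RHHeightClassK2` (p-id of 20:40Z) builds the INTRINSIC dictionary
instead (`e = ramIdx`; `n₀ ≡ 1`; on a fibre carrying a bad place `λ ≡ −r_p/e_p` with `e_p` the ramification — uniform there BY `HBand` — and `r_p` the
least certified value; elsewhere `λ = −(⌊e/(p−1)⌋+1)/e`). §1 below EXPOSES that construction as an existence statement in the currency of the Σ₁₅
binder of `RH2SigmaHull.abc_of_sigma15_v10K_window` — «`HBand X` ⟹ ∃ certified `(n₀, λ)` with `SlotReachWindow … ramIdx n₀ λ (j²·m_q) m_q`» for ANY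
pilot datum `X` and integer Kummer orders `m_q` — so that row 8 ⊆ row 15 holds AT THE DATUM LEVEL in kernel; §2 instantiates at `pilotDataOfK D K`
(integer Kummer orders exist there: `Cor312Prov.exists_nat_qPilot_pilotDataOfK`, [IUTchI] Ex. 3.2 (iv)) and composes with the companions:
`pilotKummerCompatHull_chosen_of_hBand` (the hSHw body at the certificates' bed from `HBand (pilotDataOfK D K)` ALONE) and the Σ₈ certificate
`abc_of_hBand_v10K_window` («every admissible datum off the depth locus satisfies `HBand`» · NUM(deep) · CONE ⟹ `ABC`).
[cite: DupuyHilado2025, §3.3, §3.9, §4.9] [cite: WeilBNT1967, Ch. II §2, Th. 1] [cite: NeukirchANT1999, Ch. II Prop. (5.5), Prop. (6.8)]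
[cite: Mochizuki2012, IUTchI Ex. 3.2 (iv) p. 71; IUTchIII Cor. 3.12 Step (xi-f) p. 184; IUTchIV Prop. 1.2 (i) p. 10, Prop. 1.4 (ii) p. 13]
[claim: Mochizuki2012, status: disputed] for every IUT locution. Axioms: standard.
-/

noncomputable section

open Set Function
open scoped Pointwise

namespace Summit.ABC.IUTFork.Repair.RH2SigmaHull

open Thm311 Thm311.Real Cor312 Cor312.Setting Cor312Vol Cor312Prov Literature.IUT.LogThetaLattice Literature.IUT.LogVolume
  Literature.IUT.HodgeTheaters
open Literature.NumberTheory.NumberFields Literature.NumberTheory.GaloisRepresentations.Ultrametric NumberField IsDedekindDomain Metric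
  RHSlotReach

/-! ## §1. Any pilot datum: `HBand` ⟹ a certified slot-reach dictionary (row 8 ⊆ row 15 at the datum level) -/

section AnyDatum

variable {F : Type} [Field F] [NumberField F] (X : PilotData F)

/-- **ROW 8 ⊆ ROW 15 AT THE DATUM LEVEL, in kernel.** For ANY pilot datum `X` and integer Kummer orders `m_q(w) = P_q(w)` at the bad places: if
abc-iut-lens-strengthen-1's `RHHeightClass.HBand X` holds, then there is a CERTIFIED window dictionary — `n₀ ≡ 1` (one integral non-log-unit at every
place: [IUTchIV] Prop. 1.4 (ii), `RHSlotReach.exists_norm_le_one_not_mem_logUnits`) and an outer radius `λ` witnessed by a log-unit of norm `≥ p^λ`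
(on a fibre with a bad place `λ ≡ −r_p/e_p`, `e_p` the ramification index — uniform on that fibre BY `HBand` — and `r_p` the least certified value,
`RHHeightClassGlue.exists_mem_logUnits_rpow_le_of_certVal`; elsewhere `λ = −(⌊e/(p−1)⌋+1)/e`, `exists_mem_logUnits_rpow_le_div_succ`) — for which
abc-iut-lens-wuc-1's `SlotReachWindow` holds at `e = ramIdx`, `mΘ = j²·m_q` (band cell ⟹ slot cell: `RHHeightClassGlue.slotCell_of_bandCell`,
`RHSlotReach.clause_iff_uniform`). The construction is abc-iut-rp-m2's (`RHHeightClassK2`), exposed as an existence statement. Both candidates are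
HYPOTHESES; the implication is bookkeeping. [cite: Mochizuki2012, IUTchIV Prop. 1.2 (i) p. 10, Prop. 1.4 (ii) p. 13]
[cite: NeukirchANT1999, Ch. II Prop. (5.5)] [claim: Mochizuki2012, status: disputed] -/
theorem exists_certifiedWindow_of_hBand (mq : ∀ pp : Nat.Primes, (thetaIndex X).Fibre (.inr pp) → ℤ)
    (hmq : ∀ (pp : Nat.Primes) (w : (thetaIndex X).Fibre (.inr pp)), haveI : Fact (pp : ℕ).Prime := ⟨pp.2⟩
      placeOf X pp.1 w ∈ X.S → (mq pp w : ℝ) = X.qPilot (placeOf X pp.1 w))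
    (hH : RHHeightClass.HBand X) :
    ∃ (n₀ : ∀ pp : Nat.Primes, (thetaIndex X).Fibre (.inr pp) → ℕ) (lam : ∀ pp : Nat.Primes, (thetaIndex X).Fibre (.inr pp) → ℝ),
      (∀ (pp : Nat.Primes) (x : (thetaIndex X).Fibre (.inr pp)), haveI : Fact (pp : ℕ).Prime := ⟨pp.2⟩;
        ∃ u : kOf X pp.1 x, ‖u‖ ≤ (pp : ℝ) ^ (-(((n₀ pp x : ℤ) - 1 : ℤ) : ℝ) / (ramIdx F (placeOf X pp.1 x) : ℝ)) ∧
          u ∉ (logUnits (kOf X pp.1 x) : Set (kOf X pp.1 x))) ∧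
      (∀ (pp : Nat.Primes) (x : (thetaIndex X).Fibre (.inr pp)), haveI : Fact (pp : ℕ).Prime := ⟨pp.2⟩;
        ∃ z ∈ (logUnits (kOf X pp.1 x) : Set (kOf X pp.1 x)), (pp : ℝ) ^ (lam pp x) ≤ ‖z‖) ∧
      SlotReachWindow (thetaIndex X).lstar (fun pp => (thetaIndex X).Fibre (.inr pp))
        (fun pp w => haveI : Fact (pp : ℕ).Prime := ⟨pp.2⟩; placeOf X pp.1 w ∈ X.S)
        (fun pp x => haveI : Fact (pp : ℕ).Prime := ⟨pp.2⟩; ramIdx F (placeOf X pp.1 x)) n₀ lam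
        (fun pp i w => ((((i : ℕ) : ℤ) + 1) ^ 2) * mq pp w) mq := by
  classical
  haveI hne : ∀ pp : Nat.Primes, Fact (pp : ℕ).Prime := fun pp => ⟨pp.2⟩
  have i₀ : Fin X.lstar := ⟨0, by have := X.two_le_lstar; omega⟩
  -- bad fibres, their (uniform) ramification, the least certified exponent (abc-iut-rp-m2's construction)
  set Bad : Nat.Primes → Prop := fun pp => ∃ w : (thetaIndex X).Fibre (.inr pp), placeOf X pp.1 w ∈ X.S with hBad
  set eK : Nat.Primes → ℕ := fun pp => if h : Bad pp then ramIdx F (placeOf X pp.1 h.choose) else 1 with heK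
  set rK : Nat.Primes → ℤ := fun pp =>
    if h : ∃ r : ℤ, RHHeightClass.StrictMinPow (pp : ℕ) (eK pp) r then h.choose else (eK pp : ℤ) with hrK
  set lam : ∀ pp : Nat.Primes, (thetaIndex X).Fibre (.inr pp) → ℝ := fun pp x =>
    if Bad pp then -((rK pp : ℤ) : ℝ) / ((eK pp : ℕ) : ℝ)
    else -(((ramIdx F (placeOf X pp.1 x) / ((pp : ℕ) - 1) + 1 : ℕ) : ℝ)) / (ramIdx F (placeOf X pp.1 x) : ℝ) with hlam
  have hodd : ∀ (pp : Nat.Primes) (w : (thetaIndex X).Fibre (.inr pp)), placeOf X pp.1 w ∈ X.S → 2 < (pp : ℕ) :=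
    fun pp w hw => (hH pp i₀ w hw).1
  have hunif : ∀ (pp : Nat.Primes) (w : (thetaIndex X).Fibre (.inr pp)), placeOf X pp.1 w ∈ X.S →
      ∀ x : (thetaIndex X).Fibre (.inr pp), ramIdx F (placeOf X pp.1 x) = eK pp := by
    intro pp w hw x
    have hB : Bad pp := ⟨w, hw⟩
    have h1 := (hH pp i₀ w hw).2.1
    rw [heK]
    dsimp only
    rw [dif_pos hB, h1 x, h1 hB.choose]
  have heK1 : ∀ pp : Nat.Primes, 1 ≤ eK pp := by
    intro pp
    rw [heK]
    dsimp only
    split_ifs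
    · exact Nat.one_le_iff_ne_zero.2 (ramIdx_ne_zero F _)
    · exact le_rfl
  have hcert : ∀ pp : Nat.Primes, RHHeightClass.CertVal (pp : ℕ) (eK pp) (rK pp) := by
    intro pp
    rw [hrK]
    dsimp only
    split_ifs with h
    · exact Or.inl h.choose_spec
    · exact Or.inr rfl
  have hrKle : ∀ (pp : Nat.Primes) (r : ℤ), RHHeightClass.CertVal (pp : ℕ) (eK pp) r → rK pp ≤ r := by
    intro pp r hr
    rw [hrK]
    dsimp only
    split_ifs with h
    · exact RHHeightClass.le_of_certVal_of_strictMin (heK1 pp) h.choose_spec hr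
    · exact RHHeightClassGlue.hrK_of_tie (fun r' hr' => h ⟨r', hr'⟩) r hr
  refine ⟨fun _ _ => 1, lam, fun pp x => ?_, fun pp x => ?_, fun pp i w hw x => ?_⟩
  · -- `n₀ = 1`: an integral non-log-unit ([IUTchIV] Prop. 1.4 (ii))
    obtain ⟨u, hu, hu'⟩ := exists_norm_le_one_not_mem_logUnits pp.1 (kOf X pp.1 x)
    refine ⟨u, ?_, hu'⟩
    have h0 : (-((((1 : ℕ) : ℤ) - 1 : ℤ) : ℝ) / (ramIdx F (placeOf X pp.1 x) : ℝ)) = 0 := by norm_num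
    rw [h0, Real.rpow_zero]
    exact hu
  · -- the outer radius certificate
    rw [hlam]
    dsimp only
    by_cases hB : Bad pp
    · rw [if_pos hB]
      have hw := hB.choose_spec
      have hc : RHHeightClass.CertVal (pp : ℕ) (ramIdx F (placeOf X pp.1 x)) (rK pp) := by
        rw [hunif pp _ hw x]; exact hcert pp
      have h := RHHeightClassGlue.exists_mem_logUnits_rpow_le_of_certVal X pp.1 (hodd pp _ hw) x hc
      rw [hunif pp _ hw x] at h
      exact h
    · rw [if_neg hB]
      exact RHHeightClassGlue.exists_mem_logUnits_rpow_le_div_succ X pp.1 x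
  · -- the window from the band cells
    have hw' : placeOf X pp.1 w ∈ X.S := hw
    have hB : Bad pp := ⟨w, hw'⟩
    obtain ⟨-, -, r, hcr, hcell⟩ := hH pp i w hw'
    rw [hlam]
    dsimp only
    simp only [if_pos hB, hunif pp w hw']
    rw [clause_iff_uniform (eK pp) (heK1 pp) 1 (rK pp) (i : ℕ) _ (mq pp w)]
    refine RHHeightClassGlue.slotCell_of_bandCell (heK1 pp) le_rfl (i : ℕ) ?_
    rw [hunif pp w hw' w] at hcr hcell
    have hle : ((rK pp : ℤ) : ℝ) ≤ (r : ℝ) := by exact_mod_cast hrKle pp r hcr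
    have hc : (0 : ℝ) ≤ ((i : ℕ) : ℝ) + 1 := by positivity
    have hcell' := RHHeightClass.bandCell_of_le hc hle hcell
    rw [← hmq pp w hw'] at hcell'
    exact_mod_cast hcell'

end AnyDatum

/-! ## §2. The genuine bed `pilotDataOfK D K`: integer Kummer orders exist; `HBand` ALONE gives the hSHw body; the Σ₈ certificate -/

section Genuine

variable {F K Fbar : Type} [Field F] [NumberField F] [Field K] [NumberField K] [Algebra F K] [Field Fbar]
  [Algebra F Fbar] [Algebra K Fbar] {E : WeierstrassCurve F} [E.IsElliptic] {l : ℕ} {Pb : BadPlacePredicates K}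
  (D : InitialThetaData F K Fbar E l Pb)

/-- **INTEGER Kummer orders at the genuine bed**: some `m_q : (places over p) → ℤ` has `m_q(w) = P_q(w)` at every bad place `w` of `pilotDataOfK D K`
(`2l ∣ ord_w(q)`, [IUTchI] Ex. 3.2 (iv): `Cor312Prov.exists_nat_qPilot_pilotDataOfK`; value `0` off the bad places). [cite: Mochizuki2012, IUTchI Ex. 3.2 (iv) p. 71] -/
theorem exists_intKummerOrders :
    ∃ mq : ∀ pp : Nat.Primes, (thetaIndex (pilotDataOfK D K)).Fibre (.inr pp) → ℤ,
      ∀ (pp : Nat.Primes) (w : (thetaIndex (pilotDataOfK D K)).Fibre (.inr pp)), haveI : Fact (pp : ℕ).Prime := ⟨pp.2⟩;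
        placeOf (pilotDataOfK D K) pp.1 w ∈ (pilotDataOfK D K).S →
          (mq pp w : ℝ) = (pilotDataOfK D K).qPilot (placeOf (pilotDataOfK D K) pp.1 w) := by
  classical
  haveI hne : ∀ pp : Nat.Primes, Fact (pp : ℕ).Prime := fun pp => ⟨pp.2⟩
  have h : ∀ (pp : Nat.Primes) (w : (thetaIndex (pilotDataOfK D K)).Fibre (.inr pp)), ∃ m : ℤ,
      placeOf (pilotDataOfK D K) pp.1 w ∈ (pilotDataOfK D K).S → (m : ℝ) = (pilotDataOfK D K).qPilot (placeOf (pilotDataOfK D K) pp.1 w) := by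
    intro pp w
    by_cases hw : placeOf (pilotDataOfK D K) pp.1 w ∈ (pilotDataOfK D K).S
    · obtain ⟨P, hP, -, -⟩ := exists_nat_qPilot_pilotDataOfK D hw
      exact ⟨(P : ℤ), fun _ => by rw [hP]; push_cast; rfl⟩
    · exact ⟨0, fun h => absurd h hw⟩
  choose mq hmq using h
  exact ⟨mq, hmq⟩

variable (M : Type) [Field M] [NumberField M]
  (archPk : ∀ (j : (thetaIndex (pilotDataOfK D K)).Label) (vQ : (thetaIndex (pilotDataOfK D K)).VQ),
    Set ((logShellsDH (pilotDataOfK D K) (analyticLogv K)).Packet j vQ))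
  (archSub : ∀ (j : (thetaIndex (pilotDataOfK D K)).Label) (v : (thetaIndex (pilotDataOfK D K)).V),
    Set ((logShellsDH (pilotDataOfK D K) (analyticLogv K)).Packet j ((thetaIndex (pilotDataOfK D K)).over v)))
  (Ψ : ℤ → ∀ v : (thetaIndex (pilotDataOfK D K)).V, v ∈ (thetaIndex (pilotDataOfK D K)).Vbad →
    Set ((logShellsDH (pilotDataOfK D K) (analyticLogv K)).StarPacket v))
  (act : ℤ → ∀ v : (thetaIndex (pilotDataOfK D K)).V, v ∈ (thetaIndex (pilotDataOfK D K)).Vbad →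
    (logShellsDH (pilotDataOfK D K) (analyticLogv K)).StarPacket v →
      Module.End ℚ ((logShellsDH (pilotDataOfK D K) (analyticLogv K)).StarPacket v))
  (Mmod : ℤ → ∀ j : (thetaIndex (pilotDataOfK D K)).LabelStar, Set ((logShellsDH (pilotDataOfK D K) (analyticLogv K)).GlobalPacket j.1))
  (region : ℤ → ∀ j : (thetaIndex (pilotDataOfK D K)).LabelStar, FinDivisor M → ∀ vQ : (thetaIndex (pilotDataOfK D K)).VQ,
    Set ((logShellsDH (pilotDataOfK D K) (analyticLogv K)).Packet j.1 vQ))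
  (frobAdm : ℤ → ℤ → ∀ (j : (thetaIndex (pilotDataOfK D K)).Label) (vQ : (thetaIndex (pilotDataOfK D K)).VQ),
    Set ((logShellsDH (pilotDataOfK D K) (analyticLogv K)).Packet j vQ) → Prop)
  (frobLogvol : ℤ → ℤ → ∀ (j : (thetaIndex (pilotDataOfK D K)).Label) (vQ : (thetaIndex (pilotDataOfK D K)).VQ),
    Set ((logShellsDH (pilotDataOfK D K) (analyticLogv K)).Packet j vQ) → ℝ)
  (frobΨ : ℤ → ℤ → ∀ v : (thetaIndex (pilotDataOfK D K)).V, v ∈ (thetaIndex (pilotDataOfK D K)).Vbad →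
    Set ((logShellsDH (pilotDataOfK D K) (analyticLogv K)).StarPacket v))
  (frobMmod : ℤ → ℤ → ∀ j : (thetaIndex (pilotDataOfK D K)).LabelStar,
    Set ((logShellsDH (pilotDataOfK D K) (analyticLogv K)).GlobalPacket j.1))
  (unitImage : ℤ → ℤ → ℕ → ∀ (j : (thetaIndex (pilotDataOfK D K)).Label) (vQ : (thetaIndex (pilotDataOfK D K)).VQ),
    Set ((logShellsDH (pilotDataOfK D K) (analyticLogv K)).Packet j vQ))
  (ballImage : ℤ → ℤ → ∀ (j : (thetaIndex (pilotDataOfK D K)).Label) (vQ : (thetaIndex (pilotDataOfK D K)).VQ),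
    Set ((logShellsDH (pilotDataOfK D K) (analyticLogv K)).Packet j vQ))
  (thetaDiv : ℤ → ℤ → LgpDivisor M (thetaIndex (pilotDataOfK D K)).lstar)
  (n : ℤ) {HT : Type} {LogLink : HT → HT → Type} {IsFull : ∀ {s t : HT}, LogLink s t → Prop}
  (lat : LGPGaussianLogThetaLattice LogLink IsFull)
  {Frd : Type} {IsoF : Frd → Frd → Type} {Ob : Frd → Type} {realify : Frd → Frd} {Strip : Type}
  {IsoS : Strip → Strip → Type}
  {Mv : ∀ v : (thetaIndex (pilotDataOfK D K)).V, v ∈ (thetaIndex (pilotDataOfK D K)).Vbad → Type} [∀ v h, Monoid (Mv v h)]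
  (sig : GlobalLGPFrobenioidSignature (thetaIndex (pilotDataOfK D K)).lstar (thetaIndex (pilotDataOfK D K)).V
    (· ∈ (thetaIndex (pilotDataOfK D K)).Vbad) Frd IsoF Ob realify Strip IsoS Mv)
  (split : SplittingMonoids Mv) {ObΔ : Type}
  {N : ∀ v : (thetaIndex (pilotDataOfK D K)).V, v ∈ (thetaIndex (pilotDataOfK D K)).Vbad → Type} [∀ v h, Monoid (N v h)]
  (qData : QPilotData ObΔ N)
  (qK : ∀ v : (thetaIndex (pilotDataOfK D K)).V, v ∈ (thetaIndex (pilotDataOfK D K)).Vbad →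
    Set ((logShellsDH (pilotDataOfK D K) (analyticLogv K)).StarPacket v))

/-- **ROW 8 AT THE CERTIFICATES' BED: `HBand (pilotDataOfK D K)` ALONE ⟹ the BODY of `hSHw`** (CHOSEN realising ideles, analytic logarithms; any
column binders, any `qK`): §1 at the integer Kummer orders of `exists_intKummerOrders`, then `pilotKummerCompatHull_chosen_of_slotReachWindowK`
(companion). Every dictionary binder of the round-1 door p463273 is discharged; the ONLY hypothesis is the row-8 candidate at the datum.
[cite: DupuyHilado2025, §3.9, §4.9] [cite: Mochizuki2012, IUTchI Ex. 3.2 (iv) p. 71] [claim: Mochizuki2012, status: disputed] -/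
theorem pilotKummerCompatHull_chosen_of_hBand (hH : RHHeightClass.HBand (pilotDataOfK D K)) :
    PilotKummerCompatHull
      (LatticeSituation.ofShells (logShellsDH (pilotDataOfK D K) (analyticLogv K)) M archPk archSub
        (summandPiecesPr (pilotDataOfK D K) (logvAnalytic_analyticLogv (F := K))).Adm
        (summandPiecesPr (pilotDataOfK D K) (logvAnalytic_analyticLogv (F := K))).logvol Ψ act Mmod region frobAdm frobLogvol frobΨ
        frobMmod unitImage ballImage thetaDiv)
      (settingPrVolSharp (pilotDataOfK D K) (logvAnalytic_analyticLogv (F := K)) M archPk archSub Ψ act Mmod region n lat sig split qData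
        (exists_realising_qIdeles_pilotDataOfK D).choose (exists_realising_thetaIdeles_pilotDataOfK D).choose
        (exists_realising_qIdeles_pilotDataOfK D).choose_spec.1 (exists_realising_qIdeles_pilotDataOfK D).choose_spec.2.1)
      (fun _ => (settingPrVolSharp (pilotDataOfK D K) (logvAnalytic_analyticLogv (F := K)) M archPk archSub Ψ act Mmod region n lat sig
        split qData (exists_realising_qIdeles_pilotDataOfK D).choose (exists_realising_thetaIdeles_pilotDataOfK D).choose
        (exists_realising_qIdeles_pilotDataOfK D).choose_spec.1 (exists_realising_qIdeles_pilotDataOfK D).choose_spec.2.1).qRegion)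
      qK := by
  obtain ⟨mq, hmq⟩ := exists_intKummerOrders D
  obtain ⟨n₀, lam, hn₀, hlam, hW⟩ := exists_certifiedWindow_of_hBand (pilotDataOfK D K) mq hmq hH
  exact pilotKummerCompatHull_chosen_of_slotReachWindowK D M archPk archSub Ψ act Mmod region frobAdm frobLogvol frobΨ frobMmod unitImage
    ballImage thetaDiv n lat sig split qData qK n₀ lam mq hn₀ hlam hmq ((slotReachWindowK_iff D _ _ _ _ _).2 hW)

end Genuine

/-! ## §3. The Σ₈ certificate: «every admissible datum off the depth locus satisfies `HBand`» ⟹ `ABC` -/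

section Certificate

open Literature.IUT.LogVolume.ThetaData Literature.NumberTheory.DiophantineGeometry.GenEll Summit.ABC.ABC.Theorems

/-- **`abc_of_hBand_v10K_window` — «S|Σ₈ ⟹ abc» (R-H round 2, Q2 row 8).** Branch C's certificate of record `Conditional.abc_of_SH_v10K_window`
(p447945) with its S_H binder REPLACED by «every admissible datum OFF the degree-form depth locus satisfies abc-iut-lens-strengthen-1's `HBand` at its
genuine bed `pilotDataOfK T.D T.K`»; = `abc_of_sigma15_v10K_window` ∘ §1–§2 (row 8 ⊆ row 15 at the datum level). Explicit 3 = Σ₈(window) · NUM(deep) ·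
CONE. Whether genuine data satisfy `HBand` for `l` in the typed window is Q3 (signed round-1 slice: HEX `k ≤ k₀(p,e_w,l)`), NOT claimed here. «`ABC`
follows from these hypotheses AS TYPED», nothing more; no side taken on [IUTchIII] Cor. 3.12; typed ≠ proved; instantiated ≠ endorsed.
[claim: Mochizuki2012, status: disputed] [cite: DupuyHilado2025, §3.9, §4.9] [cite: Mochizuki2012, IUTchIII Cor. 3.12 p. 173–174; IUTchIV Thm. 1.10 p. 23]
**WARNING (abc-iut-rh2-q2-hull gen 2, after referee abc-iut-rh-ref-3's binding kernel caveat of 2026-08-26): VACUOUS AS TYPED.** The binder `hreg` below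
(verbatim from p447945) is KERNEL-REFUTED — `Conditional.not_hreg_v4` (`Conditional/AbcOfSHvolRefutation.lean`; admissible `d_mod = 2` quadratic-witness
family) — so this implication, though kernel-true, can never be discharged. Its honest replacement is the re-cut (`hreg ↦ hregBad`, C-R28 (3)(α))
`abc_of_hBand_v10K_window_szpiroBadAll` in `Repair/RH2SigmaHullRecutRows.lean`; kept here as a record. -/
theorem abc_of_hBand_v10K_window
    (M : ∀ (P : NFPoint) (l : ℕ) (T : Cor22.ThetaVolumeDatumAt P l), Type) [∀ P l T, Field (M P l T)] [∀ P l T, NumberField (M P l T)]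
    (archPk : ∀ (P : NFPoint) (l : ℕ) (T : Cor22.ThetaVolumeDatumAt P l), letI := T.instFieldF; letI := T.instNumberFieldF; letI := T.instAlgebraF; letI := T.instFieldK;
        letI := T.instNumberFieldK; letI := T.instAlgebraK; letI := T.instFieldFbar; letI := T.instAlgebraFbar;
        letI := T.instAlgebraKFbar; letI := T.instIsElliptic;
      ∀ (j : (thetaIndex (pilotDataOfK T.D T.K)).Label) (vQ : (thetaIndex (pilotDataOfK T.D T.K)).VQ), Set ((logShellsDH (pilotDataOfK T.D T.K) (analyticLogv T.K)).Packet j vQ))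
    (archSub : ∀ (P : NFPoint) (l : ℕ) (T : Cor22.ThetaVolumeDatumAt P l), letI := T.instFieldF; letI := T.instNumberFieldF; letI := T.instAlgebraF; letI := T.instFieldK;
        letI := T.instNumberFieldK; letI := T.instAlgebraK; letI := T.instFieldFbar; letI := T.instAlgebraFbar;
        letI := T.instAlgebraKFbar; letI := T.instIsElliptic;
      ∀ (j : (thetaIndex (pilotDataOfK T.D T.K)).Label) (v : (thetaIndex (pilotDataOfK T.D T.K)).V), Set ((logShellsDH (pilotDataOfK T.D T.K) (analyticLogv T.K)).Packet j ((thetaIndex (pilotDataOfK T.D T.K)).over v)))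
    (Ψ : ∀ (P : NFPoint) (l : ℕ) (T : Cor22.ThetaVolumeDatumAt P l), letI := T.instFieldF; letI := T.instNumberFieldF; letI := T.instAlgebraF; letI := T.instFieldK;
        letI := T.instNumberFieldK; letI := T.instAlgebraK; letI := T.instFieldFbar; letI := T.instAlgebraFbar;
        letI := T.instAlgebraKFbar; letI := T.instIsElliptic;
      ℤ → ∀ v : (thetaIndex (pilotDataOfK T.D T.K)).V, v ∈ (thetaIndex (pilotDataOfK T.D T.K)).Vbad → Set ((logShellsDH (pilotDataOfK T.D T.K) (analyticLogv T.K)).StarPacket v))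
    (act : ∀ (P : NFPoint) (l : ℕ) (T : Cor22.ThetaVolumeDatumAt P l), letI := T.instFieldF; letI := T.instNumberFieldF; letI := T.instAlgebraF; letI := T.instFieldK;
        letI := T.instNumberFieldK; letI := T.instAlgebraK; letI := T.instFieldFbar; letI := T.instAlgebraFbar;
        letI := T.instAlgebraKFbar; letI := T.instIsElliptic;
      ℤ → ∀ v : (thetaIndex (pilotDataOfK T.D T.K)).V, v ∈ (thetaIndex (pilotDataOfK T.D T.K)).Vbad → (logShellsDH (pilotDataOfK T.D T.K) (analyticLogv T.K)).StarPacket v → Module.End ℚ ((logShellsDH (pilotDataOfK T.D T.K) (analyticLogv T.K)).StarPacket v))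
    (Mmod : ∀ (P : NFPoint) (l : ℕ) (T : Cor22.ThetaVolumeDatumAt P l), letI := T.instFieldF; letI := T.instNumberFieldF; letI := T.instAlgebraF; letI := T.instFieldK;
        letI := T.instNumberFieldK; letI := T.instAlgebraK; letI := T.instFieldFbar; letI := T.instAlgebraFbar;
        letI := T.instAlgebraKFbar; letI := T.instIsElliptic;
      ℤ → ∀ j : (thetaIndex (pilotDataOfK T.D T.K)).LabelStar, Set ((logShellsDH (pilotDataOfK T.D T.K) (analyticLogv T.K)).GlobalPacket j.1))
    (region : ∀ (P : NFPoint) (l : ℕ) (T : Cor22.ThetaVolumeDatumAt P l), letI := T.instFieldF; letI := T.instNumberFieldF; letI := T.instAlgebraF; letI := T.instFieldK;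
        letI := T.instNumberFieldK; letI := T.instAlgebraK; letI := T.instFieldFbar; letI := T.instAlgebraFbar;
        letI := T.instAlgebraKFbar; letI := T.instIsElliptic;
      ℤ → ∀ j : (thetaIndex (pilotDataOfK T.D T.K)).LabelStar, FinDivisor (M P l T) → ∀ vQ : (thetaIndex (pilotDataOfK T.D T.K)).VQ, Set ((logShellsDH (pilotDataOfK T.D T.K) (analyticLogv T.K)).Packet j.1 vQ))
    (frobAdm : ∀ (P : NFPoint) (l : ℕ) (T : Cor22.ThetaVolumeDatumAt P l), letI := T.instFieldF; letI := T.instNumberFieldF; letI := T.instAlgebraF; letI := T.instFieldK;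
        letI := T.instNumberFieldK; letI := T.instAlgebraK; letI := T.instFieldFbar; letI := T.instAlgebraFbar;
        letI := T.instAlgebraKFbar; letI := T.instIsElliptic;
      ℤ → ℤ → ∀ (j : (thetaIndex (pilotDataOfK T.D T.K)).Label) (vQ : (thetaIndex (pilotDataOfK T.D T.K)).VQ), Set ((logShellsDH (pilotDataOfK T.D T.K) (analyticLogv T.K)).Packet j vQ) → Prop)
    (frobLogvol : ∀ (P : NFPoint) (l : ℕ) (T : Cor22.ThetaVolumeDatumAt P l), letI := T.instFieldF; letI := T.instNumberFieldF; letI := T.instAlgebraF; letI := T.instFieldK;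
        letI := T.instNumberFieldK; letI := T.instAlgebraK; letI := T.instFieldFbar; letI := T.instAlgebraFbar;
        letI := T.instAlgebraKFbar; letI := T.instIsElliptic;
      ℤ → ℤ → ∀ (j : (thetaIndex (pilotDataOfK T.D T.K)).Label) (vQ : (thetaIndex (pilotDataOfK T.D T.K)).VQ), Set ((logShellsDH (pilotDataOfK T.D T.K) (analyticLogv T.K)).Packet j vQ) → ℝ)
    (frobΨ : ∀ (P : NFPoint) (l : ℕ) (T : Cor22.ThetaVolumeDatumAt P l), letI := T.instFieldF; letI := T.instNumberFieldF; letI := T.instAlgebraF; letI := T.instFieldK;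
        letI := T.instNumberFieldK; letI := T.instAlgebraK; letI := T.instFieldFbar; letI := T.instAlgebraFbar;
        letI := T.instAlgebraKFbar; letI := T.instIsElliptic;
      ℤ → ℤ → ∀ v : (thetaIndex (pilotDataOfK T.D T.K)).V, v ∈ (thetaIndex (pilotDataOfK T.D T.K)).Vbad → Set ((logShellsDH (pilotDataOfK T.D T.K) (analyticLogv T.K)).StarPacket v))
    (frobMmod : ∀ (P : NFPoint) (l : ℕ) (T : Cor22.ThetaVolumeDatumAt P l), letI := T.instFieldF; letI := T.instNumberFieldF; letI := T.instAlgebraF; letI := T.instFieldK;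
        letI := T.instNumberFieldK; letI := T.instAlgebraK; letI := T.instFieldFbar; letI := T.instAlgebraFbar;
        letI := T.instAlgebraKFbar; letI := T.instIsElliptic;
      ℤ → ℤ → ∀ j : (thetaIndex (pilotDataOfK T.D T.K)).LabelStar, Set ((logShellsDH (pilotDataOfK T.D T.K) (analyticLogv T.K)).GlobalPacket j.1))
    (unitImage : ∀ (P : NFPoint) (l : ℕ) (T : Cor22.ThetaVolumeDatumAt P l), letI := T.instFieldF; letI := T.instNumberFieldF; letI := T.instAlgebraF; letI := T.instFieldK;
        letI := T.instNumberFieldK; letI := T.instAlgebraK; letI := T.instFieldFbar; letI := T.instAlgebraFbar;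
        letI := T.instAlgebraKFbar; letI := T.instIsElliptic;
      ℤ → ℤ → ℕ → ∀ (j : (thetaIndex (pilotDataOfK T.D T.K)).Label) (vQ : (thetaIndex (pilotDataOfK T.D T.K)).VQ), Set ((logShellsDH (pilotDataOfK T.D T.K) (analyticLogv T.K)).Packet j vQ))
    (ballImage : ∀ (P : NFPoint) (l : ℕ) (T : Cor22.ThetaVolumeDatumAt P l), letI := T.instFieldF; letI := T.instNumberFieldF; letI := T.instAlgebraF; letI := T.instFieldK;
        letI := T.instNumberFieldK; letI := T.instAlgebraK; letI := T.instFieldFbar; letI := T.instAlgebraFbar;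
        letI := T.instAlgebraKFbar; letI := T.instIsElliptic;
      ℤ → ℤ → ∀ (j : (thetaIndex (pilotDataOfK T.D T.K)).Label) (vQ : (thetaIndex (pilotDataOfK T.D T.K)).VQ), Set ((logShellsDH (pilotDataOfK T.D T.K) (analyticLogv T.K)).Packet j vQ))
    (thetaDiv : ∀ (P : NFPoint) (l : ℕ) (T : Cor22.ThetaVolumeDatumAt P l), letI := T.instFieldF; letI := T.instNumberFieldF; letI := T.instAlgebraF; letI := T.instFieldK;
        letI := T.instNumberFieldK; letI := T.instAlgebraK; letI := T.instFieldFbar; letI := T.instAlgebraFbar;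
        letI := T.instAlgebraKFbar; letI := T.instIsElliptic;
      ℤ → ℤ → LgpDivisor (M P l T) (thetaIndex (pilotDataOfK T.D T.K)).lstar)
    (n : ∀ (P : NFPoint) (l : ℕ) (T : Cor22.ThetaVolumeDatumAt P l), ℤ)
    {HT : ∀ (P : NFPoint) (l : ℕ) (T : Cor22.ThetaVolumeDatumAt P l), Type} {LogLink : ∀ (P : NFPoint) (l : ℕ) (T : Cor22.ThetaVolumeDatumAt P l), HT P l T → HT P l T → Type}
    {IsFull : ∀ (P : NFPoint) (l : ℕ) (T : Cor22.ThetaVolumeDatumAt P l), ∀ {s t : HT P l T}, LogLink P l T s t → Prop}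
    (lat : ∀ (P : NFPoint) (l : ℕ) (T : Cor22.ThetaVolumeDatumAt P l), LGPGaussianLogThetaLattice (LogLink P l T) (IsFull P l T))
    {Frd : ∀ (P : NFPoint) (l : ℕ) (T : Cor22.ThetaVolumeDatumAt P l), Type} {IsoF : ∀ (P : NFPoint) (l : ℕ) (T : Cor22.ThetaVolumeDatumAt P l), Frd P l T → Frd P l T → Type} {Ob : ∀ (P : NFPoint) (l : ℕ) (T : Cor22.ThetaVolumeDatumAt P l), Frd P l T → Type}
    {realify : ∀ (P : NFPoint) (l : ℕ) (T : Cor22.ThetaVolumeDatumAt P l), Frd P l T → Frd P l T} {Strip : ∀ (P : NFPoint) (l : ℕ) (T : Cor22.ThetaVolumeDatumAt P l), Type} {IsoS : ∀ (P : NFPoint) (l : ℕ) (T : Cor22.ThetaVolumeDatumAt P l), Strip P l T → Strip P l T → Type}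
    {Mv : ∀ (P : NFPoint) (l : ℕ) (T : Cor22.ThetaVolumeDatumAt P l), letI := T.instFieldF; letI := T.instNumberFieldF; letI := T.instAlgebraF; letI := T.instFieldK;
        letI := T.instNumberFieldK; letI := T.instAlgebraK; letI := T.instFieldFbar; letI := T.instAlgebraFbar;
        letI := T.instAlgebraKFbar; letI := T.instIsElliptic;
      ∀ v : (thetaIndex (pilotDataOfK T.D T.K)).V, v ∈ (thetaIndex (pilotDataOfK T.D T.K)).Vbad → Type}
    [∀ P l T v h, Monoid (Mv P l T v h)]
    (sig : ∀ (P : NFPoint) (l : ℕ) (T : Cor22.ThetaVolumeDatumAt P l), letI := T.instFieldF; letI := T.instNumberFieldF; letI := T.instAlgebraF; letI := T.instFieldK;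
        letI := T.instNumberFieldK; letI := T.instAlgebraK; letI := T.instFieldFbar; letI := T.instAlgebraFbar;
        letI := T.instAlgebraKFbar; letI := T.instIsElliptic;
      GlobalLGPFrobenioidSignature (thetaIndex (pilotDataOfK T.D T.K)).lstar (thetaIndex (pilotDataOfK T.D T.K)).V (· ∈ (thetaIndex (pilotDataOfK T.D T.K)).Vbad) (Frd P l T) (IsoF P l T) (Ob P l T) (realify P l T)
        (Strip P l T) (IsoS P l T) (Mv P l T))
    (split : ∀ (P : NFPoint) (l : ℕ) (T : Cor22.ThetaVolumeDatumAt P l), SplittingMonoids (Mv P l T))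
    {ObΔ : ∀ (P : NFPoint) (l : ℕ) (T : Cor22.ThetaVolumeDatumAt P l), Type} {N : ∀ (P : NFPoint) (l : ℕ) (T : Cor22.ThetaVolumeDatumAt P l), letI := T.instFieldF; letI := T.instNumberFieldF; letI := T.instAlgebraF; letI := T.instFieldK;
        letI := T.instNumberFieldK; letI := T.instAlgebraK; letI := T.instFieldFbar; letI := T.instAlgebraFbar;
        letI := T.instAlgebraKFbar; letI := T.instIsElliptic;
      ∀ v : (thetaIndex (pilotDataOfK T.D T.K)).V, v ∈ (thetaIndex (pilotDataOfK T.D T.K)).Vbad → Type}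
    [∀ P l T v h, Monoid (N P l T v h)] (qData : ∀ (P : NFPoint) (l : ℕ) (T : Cor22.ThetaVolumeDatumAt P l), QPilotData (ObΔ P l T) (N P l T))
    (qK : ∀ (P : NFPoint) (l : ℕ) (T : Cor22.ThetaVolumeDatumAt P l), letI := T.instFieldF; letI := T.instNumberFieldF; letI := T.instAlgebraF; letI := T.instFieldK;
        letI := T.instNumberFieldK; letI := T.instAlgebraK; letI := T.instFieldFbar; letI := T.instAlgebraFbar;
        letI := T.instAlgebraKFbar; letI := T.instIsElliptic;
      ∀ v : (thetaIndex (pilotDataOfK T.D T.K)).V, v ∈ (thetaIndex (pilotDataOfK T.D T.K)).Vbad → Set ((logShellsDH (pilotDataOfK T.D T.K) (analyticLogv T.K)).StarPacket v))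
    -- [S_H, WINDOW] the hull-level clause at the chosen realising ideles / pinned reading, ONLY at admissible data OFF the depth locus
    -- [Σ₈, WINDOW] every admissible datum OFF the depth locus satisfies the row-8 candidate `HBand` at its genuine bed
    (hSigma8 : ∀ (P : NFPoint), P ∈ UP → ∀ (l : ℕ), l.Prime → 5 ≤ l →
      Cor22.AdmitsCore P → Cor22.CondP2 P l → Cor22.CondP5 P l → Cor22.CondP6 P l →
      ∀ (T : Cor22.ThetaVolumeDatumAt P l), letI := T.instFieldF; letI := T.instNumberFieldF; letI := T.instAlgebraF; letI := T.instFieldK;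
        letI := T.instNumberFieldK; letI := T.instAlgebraK; letI := T.instFieldFbar; letI := T.instAlgebraFbar;
        letI := T.instAlgebraKFbar; letI := T.instIsElliptic;
      ¬ (∃ (pp : Nat.Primes) (_ : 2 < (pp : ℕ)) (i : Fin (thetaIndex (pilotDataOfK T.D T.K)).lstar)
          (x₀ : (thetaIndex (pilotDataOfK T.D T.K)).Fibre (.inr pp)),
        haveI : Fact (pp : ℕ).Prime := ⟨pp.2⟩
        ((pp : ℕ) : ℝ) ^ ((((i : ℕ) : ℝ) + 2) * (4 + 2 * Real.logb (pp : ℕ) (Module.finrank ℚ T.K)) + 1) *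
          ‖(exists_realising_qIdeles_pilotDataOfK T.D).choose pp x₀‖ ^ (((i : ℕ) + 1) ^ 2 - 1) < 1) →
      RHHeightClass.HBand (pilotDataOfK T.D T.K))
    (hNum : ∀ (P : NFPoint), P ∈ UP → ∀ (l : ℕ), l.Prime → 5 ≤ l →
      Cor22.AdmitsCore P → Cor22.CondP2 P l → Cor22.CondP5 P l → Cor22.CondP6 P l →
      ∀ (T : Cor22.ThetaVolumeDatumAt P l), letI := T.instFieldF; letI := T.instNumberFieldF; letI := T.instAlgebraF; letI := T.instFieldK;
        letI := T.instNumberFieldK; letI := T.instAlgebraK; letI := T.instFieldFbar; letI := T.instAlgebraFbar;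
        letI := T.instAlgebraKFbar; letI := T.instIsElliptic;
      (∃ (pp : Nat.Primes) (_ : 2 < (pp : ℕ)) (i : Fin (thetaIndex (pilotDataOfK T.D T.K)).lstar)
          (x₀ : (thetaIndex (pilotDataOfK T.D T.K)).Fibre (.inr pp)),
        haveI : Fact (pp : ℕ).Prime := ⟨pp.2⟩
        ((pp : ℕ) : ℝ) ^ ((((i : ℕ) : ℝ) + 2) * (4 + 2 * Real.logb (pp : ℕ) (Module.finrank ℚ T.K)) + 1) *
          ‖(exists_realising_qIdeles_pilotDataOfK T.D).choose pp x₀‖ ^ (((i : ℕ) + 1) ^ 2 - 1) < 1) → T.Cor312Of)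
    (hreg : ∀ P : NFPoint, P ∈ UP → ∀ l : ℕ, l.Prime → 5 ≤ l →
      Cor22.AdmitsCore P → Cor22.CondP2 P l → Cor22.CondP5 P l → Cor22.CondP6 P l →
      ∀ T : Cor22.ThetaVolumeDatumAt P l,
        (letI := T.instFieldF; letI := T.instNumberFieldF; letI := T.instAlgebraF; letI := T.instFieldK
         letI := T.instNumberFieldK; letI := T.instAlgebraK; letI := T.instFieldFbar; letI := T.instAlgebraFbar
         letI := T.instAlgebraKFbar; letI := T.instIsElliptic
         ¬ (∀ p ∈ T.I.supportPrimes, ∀ v w : placesOver (fieldOfModuli T.E) p,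
            (Summit.ABC.IUTFork.DHData.ofInput T.I).logQloc p v = (Summit.ABC.IUTFork.DHData.ofInput T.I).logQloc p w)) →
        T.HullEstimateOf
          (((l : ℝ) + 1) / 4 *
            ((1 + 12 * (Cor22.dmod P : ℝ) / l) * (P.logDiff + Cor22.logCondAvoid P {2, l})
              + 2 * Real.log l + 52
              + 20 / 3 * Real.log (((2 ^ 12 * 3 ^ 3 * 5 * Cor22.dmod P : ℕ) : ℝ) * (l : ℝ))
                * (Nat.primeCounting (2 ^ 12 * 3 ^ 3 * 5 * Cor22.dmod P * l) : ℝ))))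
    : _root_.ABC :=
  abc_of_sigma15_v10K_window (M := M) (archPk := archPk) (archSub := archSub) (Ψ := Ψ) (act := act) (Mmod := Mmod) (region := region)
    (frobAdm := frobAdm) (frobLogvol := frobLogvol) (frobΨ := frobΨ) (frobMmod := frobMmod) (unitImage := unitImage) (ballImage := ballImage)
    (thetaDiv := thetaDiv) (n := n) (lat := lat) (sig := sig) (split := split) (qData := qData) (qK := qK) (hNum := hNum) (hreg := hreg)
    (hSigma := fun P hP l hl h5 hc h2 h5' h6 T hT => by
      letI := T.instFieldF; letI := T.instNumberFieldF; letI := T.instAlgebraF; letI := T.instFieldK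
      letI := T.instNumberFieldK; letI := T.instAlgebraK; letI := T.instFieldFbar; letI := T.instAlgebraFbar
      letI := T.instAlgebraKFbar; letI := T.instIsElliptic
      obtain ⟨mq, hmq⟩ := exists_intKummerOrders T.D
      obtain ⟨n₀, lam, hn₀, hlam, hW⟩ := exists_certifiedWindow_of_hBand (pilotDataOfK T.D T.K) mq hmq
        (hSigma8 P hP l hl h5 hc h2 h5' h6 T hT)
      exact ⟨n₀, lam, mq, hn₀, hlam, hmq, (slotReachWindowK_iff T.D _ _ _ _ _).2 hW⟩)

end Certificate

end Summit.ABC.IUTFork.Repair.RH2SigmaHull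

end
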